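import Summits.BirchSwinnertonDyer.BirchSwinnertonDyer.Theorems.KatoDescentPotSupersingularKatoFiniteLevelStrictCanonical
import Summits.BirchSwinnertonDyer.Rank1Residual.X10.ResidualSelmerCompanions
import Literature.NumberTheory.EllipticCurves.Kato2004.IwasawaH1ReductionPk
import Literature.NumberTheory.EllipticCurves.Kato2004.LocPKernelRankOnePlumbing
import HarnessLib

/-!
# Kato's (14.9.3) at finite level, part 17: the COMPACT HALF, step 1 — the map
# `A = H¹(ℤ[1/p], T_pE) → H¹_ℛ(ℚ, E[p^k])`, `c ↦ c mod p^k`, and `#(A / ker) ≤ #H¹_ℛ(ℚ, E[p^k])` with `ker ⊇ p^k A`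
# (route `KatoDescentPotSupersingular` / `…Tame…`, crux M = stmt-BirchSwinnertonDyer-19196 `ReducibleKatoMember`; route-free helper)

Seat `bsd-potss-rkm` g17 (prover; cell `bsd-potss`), item stmt-BirchSwinnertonDyer-19196 (`--supports … --as helper`; closes
nothing).  HONEST FRAMING: BSD is not proved by any of this; nothing is booked; theorems only (no definition, no named fact).

Kato, proof of Prop. 14.16 (pp. 244–245): the image of `H¹(ℤ[1/p], T)` in `H¹(ℤ[1/p], T/p^k) = H¹_ℛ(ℚ, E[p^k])` is
`H¹(ℤ[1/p],T)/p^k`, of order `p^k · #(torsion)`; comparing with the count of `#H¹_ℛ` (parts 1–16) bounds the index of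
`z` in `H¹(ℤ[1/p],T)`.  Here, with the tree's PINNED objects — `A := Kato2004.integralH1 (tateRep W p) p ⊤` (classes of
`H¹(ℚ, T_pE)` unramified outside `p`, Kato §8.2), the reduction `Kato2004.reduceH1Pk W p k ⊤ : H¹(⊤, T_pE) → H¹(⊤, E[p^k])`
(§13.8) and `ofTopSubgroup : H¹(⊤, ·) → H¹(Γ_ℚ, ·)`:

* **`ofTopSubgroup_reduceH1Pk_mem_selmerGroup`** — for `c ∈ A`, `(c mod p^k) ∈ H¹_ℛ(ℚ, E[p^k])` for every Kato relaxed structure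
  `ℛ` (everything at `v_p` and at `∞`, unramified at every prime `ℓ ≠ p`): tree `reduceH1Pk_mem_integralH1` (integrality is
  preserved), `ofTopSubgroup_mem_unramifiedKer_of_mem_integralH1` (integral ⟹ principal on `I_𝔓`), and the currency bridge
  `X10.localization_mem_unramifiedSubgroup_iff_mem_unramifiedKer` (principal on `I_{𝔓_ℓ}` ⟺ `loc_ℓ ∈ H¹_ur(ℚ_ℓ, ·)`).
* **`reduceToSelmer`-free packaging**: `exists_addMonoidHom_integralH1_to_selmerGroup` — an additive map `f : A →+ H¹_ℛ(ℚ,E[p^k])`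
  with `f c = c mod p^k`, killing `p^k • A` (`reduceH1Pk_pow_smul`), whence
  **`natCard_integralH1_quot_ker_le`**: `#(A ⧸ ker f) ≤ #H¹_ℛ(ℚ, E[p^k])`.
  NOT here (the remaining step of the compact half): `ker (reduceH1Pk ⊤) = p^k · H¹(⊤, T_pE)` (long exact sequence of
  `0 → T →p^k→ T → E[p^k] → 0` for the compact `T`), which upgrades `ker f ⊇ p^k A` to `ker f = A ∩ p^k H¹(ℚ, T_pE)`.

References: K. Kato, Astérisque 295 (2004) §8.2, §13.8, (14.9.3), proof of Prop. 14.16 (pp. 244–245) [Kato2004Asterisque].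
-/

-- the summit and its single problem are both named `BirchSwinnertonDyer` (registry layout D-0017)
set_option linter.dupNamespace false
set_option autoImplicit false

noncomputable section

open scoped Classical ContRepresentation NumberField
open Function Field NumberField IsDedekindDomain
open Literature.NumberTheory.EllipticCurves Literature.NumberTheory.GaloisRepresentations
  Literature.NumberTheory.GaloisRepresentations.DiscreteGaloisModule Literature.NumberTheory.GaloisCohomology
open Literature.NumberTheory.EllipticCurves.Kato2004 Literature.NumberTheory.EllipticCurves.Kato2004.EulerSystemValues
open WeierstrassCurve (geomTorsion)

namespace Summit.BirchSwinnertonDyer.BirchSwinnertonDyer.Theorems.KatoFiniteLevelCount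

section CompactMap

variable (W : WeierstrassCurve ℚ) [W.IsElliptic] (p : ℕ) [Fact p.Prime] (k : ℕ) [ContinuousSMul ℤ_[p] (W.tateModule p)]

/-- A place `v` of `ℚ` with `v ≠ v_p` has residue characteristic `≠ p`. [folklore] -/
theorem primesEquiv_ne_of_ne_primePlace {v : HeightOneSpectrum (𝓞 ℚ)} (hv : v ≠ primePlace p) :
    ((Rat.HeightOneSpectrum.primesEquiv v : Nat.Primes) : ℕ) ≠ p := by
  intro h
  apply hv
  apply (Rat.HeightOneSpectrum.primesEquiv (R := 𝓞 ℚ)).injective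
  rw [primesEquiv_primePlace]
  exact Subtype.ext h

/-- **`c mod p^k ∈ H¹_ℛ(ℚ, E[p^k])` for every `c ∈ A = H¹(ℤ[1/p], T_pE)`** (`A = Kato2004.integralH1 (tateRep W p) p ⊤`) and
every Kato relaxed structure `ℛ` on `E[p^k]` (everything at `v_p` and at the infinite place, unramified at every prime `≠ p`):
integrality survives reduction mod `p^k` (tree `reduceH1Pk_mem_integralH1`), an integral class is principal on every inertia group
above `ℓ ≠ p` (tree `ofTopSubgroup_mem_unramifiedKer_of_mem_integralH1`), which is the unramified local condition at `ℓ` (tree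
`localization_mem_unramifiedSubgroup_iff_mem_unramifiedKer`). [cite: Kato2004Asterisque, §8.2 (p. 180), §13.8 (p. 228) and proof of Prop. 14.16 (pp. 244–245)] -/
theorem ofTopSubgroup_reduceH1Pk_mem_selmerGroup (ℛ : SelmerStructure (W.torsionGaloisModule ((p : ℤ) ^ k)))
    (hℛP : ℛ (Sum.inr (primePlace p)) = ⊤)
    (hℛur : ∀ v : HeightOneSpectrum (𝓞 ℚ), v ≠ primePlace p →
      ℛ (Sum.inr v) = unramifiedSubgroup (GaloisRep.toLocal v (W.torsionGaloisModule ((p : ℤ) ^ k))) 1)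
    (hℛinl : ∀ w : InfinitePlace ℚ, ℛ (Sum.inl w) = ⊤)
    {c : H1 (tateRep W p) ⊤} (hc : c ∈ integralH1 (tateRep W p) p ⊤) :
    (ofTopSubgroup (W.torsionGaloisModule ((p : ℤ) ^ k)).toTopRep 1).hom (reduceH1Pk W p k ⊤ c) ∈ ℛ.selmerGroup := by
  have hr := reduceH1Pk_mem_integralH1 W p k ⊤ hc
  refine (SelmerStructure.mem_selmerGroup_iff _ _).mpr fun pl => ?_
  rcases pl with w | v
  · rw [hℛinl w]; exact AddSubgroup.mem_top _
  · by_cases hv : v = primePlace p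
    · subst hv; rw [hℛP]; exact AddSubgroup.mem_top _
    · rw [hℛur v hv]
      exact (Rank1Residual.X10.ResidualSelmerCompanions.localization_mem_unramifiedSubgroup_iff_mem_unramifiedKer
          W ((p : ℤ) ^ k) v _).mpr
        (ofTopSubgroup_mem_unramifiedKer_of_mem_integralH1 W p ((p : ℤ) ^ k) hr
          (primesEquiv_ne_of_ne_primePlace p hv) (adicCompletionPrime_mem_primesAbove ℚ v))

/-- **The reduction `A → H¹_ℛ(ℚ, E[p^k])` as an additive map killing `p^k • A`**, and the consequent bound
**`#(A ⧸ ker) ≤ #H¹_ℛ(ℚ, E[p^k])`** (`A = H¹(ℤ[1/p], T_pE)` pinned as `Kato2004.integralH1 (tateRep W p) p ⊤`).  The kernel contains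
`p^k A` (tree `reduceH1Pk_pow_smul`); its identification with `A ∩ p^k H¹(ℚ, T_pE)` is the remaining step of the compact half.
[cite: Kato2004Asterisque, §13.8 (p. 228) and proof of Prop. 14.16 (pp. 244–245)] -/
theorem exists_addMonoidHom_integralH1_to_selmerGroup (ℛ : SelmerStructure (W.torsionGaloisModule ((p : ℤ) ^ k)))
    (hℛP : ℛ (Sum.inr (primePlace p)) = ⊤)
    (hℛur : ∀ v : HeightOneSpectrum (𝓞 ℚ), v ≠ primePlace p →
      ℛ (Sum.inr v) = unramifiedSubgroup (GaloisRep.toLocal v (W.torsionGaloisModule ((p : ℤ) ^ k))) 1)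
    (hℛinl : ∀ w : InfinitePlace ℚ, ℛ (Sum.inl w) = ⊤) :
    ∃ f : integralH1 (tateRep W p) p ⊤ →+ ℛ.selmerGroup,
      (∀ c : integralH1 (tateRep W p) p ⊤,
        ((f c : ℛ.selmerGroup) : galoisCohomology (W.torsionGaloisModule ((p : ℤ) ^ k)) 1) =
          (ofTopSubgroup (W.torsionGaloisModule ((p : ℤ) ^ k)).toTopRep 1).hom
            (reduceH1Pk W p k ⊤ (c : H1 (tateRep W p) ⊤))) ∧
      (∀ c : integralH1 (tateRep W p) p ⊤, f (((p : ℤ_[p]) ^ k) • c) = 0) ∧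
      (Finite ℛ.selmerGroup → Nat.card (integralH1 (tateRep W p) p ⊤ ⧸ f.ker) ≤ Nat.card ℛ.selmerGroup) := by
  let f : integralH1 (tateRep W p) p ⊤ →+ ℛ.selmerGroup :=
    { toFun := fun c => ⟨(ofTopSubgroup (W.torsionGaloisModule ((p : ℤ) ^ k)).toTopRep 1).hom
          (reduceH1Pk W p k ⊤ (c : H1 (tateRep W p) ⊤)),
        ofTopSubgroup_reduceH1Pk_mem_selmerGroup W p k ℛ hℛP hℛur hℛinl c.2⟩
      map_zero' := Subtype.ext (by simp; rfl)
      map_add' := fun a b => Subtype.ext (by simp; rfl) }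
  refine ⟨f, fun c => rfl, fun c => ?_, fun hfin => ?_⟩
  · apply Subtype.ext
    change (ofTopSubgroup (W.torsionGaloisModule ((p : ℤ) ^ k)).toTopRep 1).hom
      (reduceH1Pk W p k ⊤ ((((p : ℤ_[p]) ^ k) • c : integralH1 (tateRep W p) p ⊤) : H1 (tateRep W p) ⊤)) = 0
    rw [Submodule.coe_smul, reduceH1Pk_pow_smul, map_zero]
  · haveI := hfin
    rw [Nat.card_congr (QuotientAddGroup.quotientKerEquivRange f).toEquiv]
    exact Nat.card_le_card_of_injective _ f.range.subtype_injective

end CompactMap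

end Summit.BirchSwinnertonDyer.BirchSwinnertonDyer.Theorems.KatoFiniteLevelCount

end
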